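import Summits.Ventures.HSemireg.SignedPureWeilAxisCertificates
import Summits.Ventures.HSemireg.SignedPureWeilMinimalDesigns

/-!
# Venture HSemireg — pure designs on (ℤ∕4)² with at most five letters have real-or-imaginary Weil moment (KERNEL, unconditional),
# hence s(3) ≥ 12, s(4) ≥ 24, s(5) ≥ 48, s(6) ≥ 96 in the kernel by the slice-angle THEOREM B and LEMMA S

HONEST FRAMING. Part of the Lean index of the computation cell `pub-hsemireg` (Sunday typer seat p9, § g = 8; family B row **B20-3**:
signed pure-Weil designs are «class witnesses — cycles with ℤ-coefficients — not census objects»). FINITE GAUSSIAN-INTEGER ARITHMETIC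
ONLY, in the vocabulary of `SignedPureWeilLadder.lean` (`Letter`, `Eps`, `vchi`, `vmoment`, `plus`, `minus`, `supp`),
`SignedPureWeilTransport.lean` (`shift`), `SignedPureWeilAngles.lean` (`IsAxis`, `IsDiag`, THEOREM B
`two_mul_min_le_card_supp_of_classes`), `SignedPureWeilAxisCertificates.lean` (`lcomb`, `re_eq_zero_of_lcert`, `im_eq_zero_of_lcert`)
and `SignedPureWeilMinimalDesigns.lean` (`card_support_step`). Nothing here says that HC ∕ HC_CM ∕ HC_AV holds; no object is certified;
no Literature fact is declared; no verdict ∕ door word ∕ count of the cell moves. EVERYTHING IN THIS FILE IS UNCONDITIONAL (no machine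
hypothesis): the kernel's lower ends of the ladder s(n) = min #supp of a pure W-alive ℤ-design on (ℤ∕4)ⁿ move from 8 ∕ 16 ∕ 32 ∕ 64
(`two_pow_le_card_support_pure`) to **12 ∕ 24 ∕ 48 ∕ 96** for n = 3 ∕ 4 ∕ 5 ∕ 6 (machine truth of record: 14 ∕ 28 ∕ [64, 80] ∕ [128, 184]).

THE ARGUMENT (record file `HOME/p9/S5-ANGLE-p9g9.md`, level-2 section). §1 Twenty 4-letter subsets T of (ℤ∕4)² — the sixteen 2 × 2
boxes {a, a+1} × {b, b+1} and the four cosets of 2(ℤ∕4)² — each with a short ℤ[i]-combination of VISIBLE characters that agrees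
with i^{|x|} + i^{−|x|} (ten of them) or with i^{|x|} − i^{−|x|} (the other ten) at every letter OUTSIDE T (`decide`); by §1 of
`SignedPureWeilAxisCertificates.lean` a pure design whose support avoids such a T has Re W = 0, resp. Im W = 0 (§2). §3 COVERING
LEMMA: every subset of (ℤ∕4)² with at most five letters that contains the letter 0 avoids one of the twenty T (`decide` over
non-decreasing code 4-tuples + a sorting bridge); a translate of the design puts a support letter at 0 (`shift`), so (§4,
**`isAxis_of_card_le_five`**) every pure design on (ℤ∕4)² with ≤ 5 letters is axis. Hence the class minima of THEOREM B at n = 2 are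
B₁ (diagonal) ≥ 6, B₂ (axis) ≥ 4 (`two_pow_le_card_support_pure`), B₃ (other) ≥ 6, and s(3) ≥ 2·min(max(6, 4), 6) = 12 (§5,
**`twelve_le_card_supp`**); LEMMA S doubles it three times (`s4_ge_24`, `s5_ge_48`, `s6_ge_96`). The machine truth at n = 2 is
(s_axis, s_diag, s_other)(2) = (4, 6, 7) (brute force over all subsets, record file §2), so the kernel value 12 is what the angle
method yields from level 2 alone; s(3) = 14 itself stays machine (`SignedPureWeilMinimalDesigns.lean` docstring).
-/

namespace Summit.Ventures.HSemireg.SignedWeilDesignN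

open Finset

/-! ## §1 The twenty avoided sets and their certificates (letters of (ℤ∕4)² coded `x₀ + 4x₁`) -/

/-- The code `x₀ + 4x₁ ∈ Fin 16` of a letter of (ℤ∕4)². [definition of this file] -/
def enc (x : Letter 2) : Fin 16 := ⟨(x 0).val + 4 * (x 1).val, by have := (x 0).isLt; have := (x 1).isLt; omega⟩

/-- The ten avoided 4-sets of REAL type (codes): avoiding one of them forces Re W = 0. [definition of this file] -/
def TR : Fin 10 → List (Fin 16) := ![[5, 7, 13, 15], [0, 2, 8, 10], [9, 10, 13, 14], [6, 7, 10, 11], [8, 11, 12, 15], [4, 5, 8, 9], [2, 3, 14, 15], [1, 2, 5, 6], [0, 3, 4, 7], [0, 1, 12, 13]]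

/-- The ten avoided 4-sets of IMAGINARY type (codes): avoiding one of them forces Im W = 0. [definition of this file] -/
def TI : Fin 10 → List (Fin 16) := ![[10, 11, 14, 15], [8, 9, 12, 13], [2, 3, 6, 7], [0, 1, 4, 5], [5, 6, 9, 10], [4, 7, 8, 11], [1, 2, 13, 14], [0, 3, 12, 15], [4, 6, 12, 14], [1, 3, 9, 11]]

/-- The certificates of real type (visible characters of (ℤ∕4)² with Gaussian coefficients). [definition of this file] -/
def certR : Fin 10 → List (Eps 2 × GaussianInt) := ![
  [(![1, 2], ⟨1, 0⟩), (![2, 1], ⟨1, 0⟩)],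
  [(![1, 2], ⟨-1, 0⟩), (![2, 1], ⟨-1, 0⟩)],
  [(![0, 0], ⟨-2, 0⟩), (![0, 1], ⟨1, -1⟩), (![0, 2], ⟨1, 1⟩), (![1, 0], ⟨1, 1⟩), (![1, 2], ⟨0, -1⟩), (![2, 0], ⟨1, -1⟩), (![2, 1], ⟨0, 1⟩)],
  [(![0, 0], ⟨-2, 0⟩), (![0, 1], ⟨1, 1⟩), (![0, 2], ⟨1, -1⟩), (![1, 0], ⟨1, -1⟩), (![1, 2], ⟨0, 1⟩), (![2, 0], ⟨1, 1⟩), (![2, 1], ⟨0, -1⟩)],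
  [(![0, 0], ⟨2, 0⟩), (![0, 1], ⟨-1, 1⟩), (![0, 2], ⟨-1, -1⟩), (![1, 0], ⟨1, 1⟩), (![1, 2], ⟨0, -1⟩), (![2, 0], ⟨1, -1⟩), (![2, 1], ⟨0, 1⟩)],
  [(![0, 0], ⟨2, 0⟩), (![0, 1], ⟨-1, -1⟩), (![0, 2], ⟨-1, 1⟩), (![1, 0], ⟨1, -1⟩), (![1, 2], ⟨0, 1⟩), (![2, 0], ⟨1, 1⟩), (![2, 1], ⟨0, -1⟩)],
  [(![0, 0], ⟨2, 0⟩), (![0, 1], ⟨1, 1⟩), (![0, 2], ⟨1, -1⟩), (![1, 0], ⟨-1, 1⟩), (![1, 2], ⟨0, 1⟩), (![2, 0], ⟨-1, -1⟩), (![2, 1], ⟨0, -1⟩)],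
  [(![0, 0], ⟨2, 0⟩), (![0, 1], ⟨1, -1⟩), (![0, 2], ⟨1, 1⟩), (![1, 0], ⟨-1, -1⟩), (![1, 2], ⟨0, -1⟩), (![2, 0], ⟨-1, 1⟩), (![2, 1], ⟨0, 1⟩)],
  [(![0, 0], ⟨-2, 0⟩), (![0, 1], ⟨-1, 1⟩), (![0, 2], ⟨-1, -1⟩), (![1, 0], ⟨-1, -1⟩), (![1, 2], ⟨0, -1⟩), (![2, 0], ⟨-1, 1⟩), (![2, 1], ⟨0, 1⟩)],
  [(![0, 0], ⟨-2, 0⟩), (![0, 1], ⟨-1, -1⟩), (![0, 2], ⟨-1, 1⟩), (![1, 0], ⟨-1, 1⟩), (![1, 2], ⟨0, 1⟩), (![2, 0], ⟨-1, -1⟩), (![2, 1], ⟨0, -1⟩)]]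

/-- The certificates of imaginary type. [definition of this file] -/
def certI : Fin 10 → List (Eps 2 × GaussianInt) := ![
  [(![0, 0], ⟨0, -2⟩), (![0, 1], ⟨1, 1⟩), (![0, 2], ⟨-1, 1⟩), (![1, 0], ⟨1, 1⟩), (![1, 2], ⟨0, -1⟩), (![2, 0], ⟨-1, 1⟩), (![2, 1], ⟨0, -1⟩)],
  [(![0, 0], ⟨0, 2⟩), (![0, 1], ⟨-1, -1⟩), (![0, 2], ⟨1, -1⟩), (![1, 0], ⟨1, 1⟩), (![1, 2], ⟨0, -1⟩), (![2, 0], ⟨-1, 1⟩), (![2, 1], ⟨0, -1⟩)],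
  [(![0, 0], ⟨0, 2⟩), (![0, 1], ⟨1, 1⟩), (![0, 2], ⟨-1, 1⟩), (![1, 0], ⟨-1, -1⟩), (![1, 2], ⟨0, -1⟩), (![2, 0], ⟨1, -1⟩), (![2, 1], ⟨0, -1⟩)],
  [(![0, 0], ⟨0, -2⟩), (![0, 1], ⟨-1, -1⟩), (![0, 2], ⟨1, -1⟩), (![1, 0], ⟨-1, -1⟩), (![1, 2], ⟨0, -1⟩), (![2, 0], ⟨1, -1⟩), (![2, 1], ⟨0, -1⟩)],
  [(![0, 0], ⟨0, 2⟩), (![0, 1], ⟨1, -1⟩), (![0, 2], ⟨-1, -1⟩), (![1, 0], ⟨1, -1⟩), (![1, 2], ⟨0, 1⟩), (![2, 0], ⟨-1, -1⟩), (![2, 1], ⟨0, 1⟩)],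
  [(![0, 0], ⟨0, -2⟩), (![0, 1], ⟨-1, 1⟩), (![0, 2], ⟨1, 1⟩), (![1, 0], ⟨1, -1⟩), (![1, 2], ⟨0, 1⟩), (![2, 0], ⟨-1, -1⟩), (![2, 1], ⟨0, 1⟩)],
  [(![0, 0], ⟨0, -2⟩), (![0, 1], ⟨1, -1⟩), (![0, 2], ⟨-1, -1⟩), (![1, 0], ⟨-1, 1⟩), (![1, 2], ⟨0, 1⟩), (![2, 0], ⟨1, 1⟩), (![2, 1], ⟨0, 1⟩)],
  [(![0, 0], ⟨0, 2⟩), (![0, 1], ⟨-1, 1⟩), (![0, 2], ⟨1, 1⟩), (![1, 0], ⟨-1, 1⟩), (![1, 2], ⟨0, 1⟩), (![2, 0], ⟨1, 1⟩), (![2, 1], ⟨0, 1⟩)],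
  [(![1, 2], ⟨1, 0⟩), (![2, 1], ⟨-1, 0⟩)],
  [(![1, 2], ⟨-1, 0⟩), (![2, 1], ⟨1, 0⟩)]]

/-- All certificate characters are visible. -/
theorem certR_visible : ∀ j : Fin 10, ∀ p ∈ certR j, p.1 ≠ plus ∧ p.1 ≠ minus := by decide

/-- All certificate characters are visible. -/
theorem certI_visible : ∀ j : Fin 10, ∀ p ∈ certI j, p.1 ≠ plus ∧ p.1 ≠ minus := by decide

/-- **The real-type identities:** outside `TR j`, `lcomb (certR j) = i^{|x|} + i^{−|x|}` (kernel `decide`, 10 × 16 letters). -/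
theorem certR_holds : ∀ j : Fin 10, ∀ x : Letter 2, enc x ∉ TR j → lcomb (certR j) x = vchi plus x + vchi minus x := by decide

/-- **The imaginary-type identities:** outside `TI j`, `lcomb (certI j) = i^{|x|} − i^{−|x|}` (kernel `decide`). -/
theorem certI_holds : ∀ j : Fin 10, ∀ x : Letter 2, enc x ∉ TI j → lcomb (certI j) x = vchi plus x - vchi minus x := by decide

/-! ## §2 A pure design whose support avoids one of the twenty sets is axis -/

/-- Avoiding a real-type set forces `Re W = 0`. -/
theorem re_eq_zero_of_avoids (d : Letter 2 → ℤ) (hpure : ∀ ε : Eps 2, ε ≠ plus → ε ≠ minus → vmoment d ε = 0) (j : Fin 10)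
    (havoid : ∀ x, d x ≠ 0 → enc x ∉ TR j) : (vmoment d plus).re = 0 :=
  re_eq_zero_of_lcert (certR j) (certR_visible j) 1 one_ne_zero d hpure
    (fun x hx => by rw [certR_holds j x (havoid x hx)]; push_cast; ring)

/-- Avoiding an imaginary-type set forces `Im W = 0`. -/
theorem im_eq_zero_of_avoids (d : Letter 2 → ℤ) (hpure : ∀ ε : Eps 2, ε ≠ plus → ε ≠ minus → vmoment d ε = 0) (j : Fin 10)
    (havoid : ∀ x, d x ≠ 0 → enc x ∉ TI j) : (vmoment d plus).im = 0 :=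
  im_eq_zero_of_lcert (certI j) (certI_visible j) 1 one_ne_zero d hpure
    (fun x hx => by rw [certI_holds j x (havoid x hx)]; push_cast; ring)

/-! ## §3 The covering lemma: at most five letters including 0 always avoid one of the twenty sets -/

/-- Boolean test: the codes `0, b, c, d, e` avoid the list `T`. [definition of this file] -/
def avoidsB (T : List (Fin 16)) (b c d e : Fin 16) : Bool :=
  !(T.contains 0) && !(T.contains b) && !(T.contains c) && !(T.contains d) && !(T.contains e)

/-- Boolean form of the covering test for the codes `0, b, c, d, e`. [definition of this file] -/
def coverB (b c d e : Fin 16) : Bool :=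
  (List.finRange 10).any (fun j => avoidsB (TR j) b c d e) || (List.finRange 10).any (fun j => avoidsB (TI j) b c d e)

/-- **Covering, tuple form** (kernel `decide` over the non-decreasing code 4-tuples). -/
theorem coverB_eq_true : ∀ b c d e : Fin 16, b ≤ c → c ≤ d → d ≤ e → coverB b c d e = true := by
  decide

/-- From the Boolean test to avoidance. -/
theorem not_mem_of_avoidsB {T : List (Fin 16)} {b c d e : Fin 16} (h : avoidsB T b c d e = true) :
    (0 : Fin 16) ∉ T ∧ b ∉ T ∧ c ∉ T ∧ d ∉ T ∧ e ∉ T := by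
  simp only [avoidsB, Bool.and_eq_true, Bool.not_eq_eq_eq_not, Bool.not_true, List.contains_eq_mem, decide_eq_false_iff_not] at h
  exact ⟨h.1.1.1.1, h.1.1.1.2, h.1.1.2, h.1.2, h.2⟩

/-- The letters coded `0, b, c, d, e` (non-decreasing) avoid some `TR j` or some `TI j`. -/
theorem cover_tuple (b c d e : Fin 16) (hbc : b ≤ c) (hcd : c ≤ d) (hde : d ≤ e) :
    (∃ j : Fin 10, (0 : Fin 16) ∉ TR j ∧ b ∉ TR j ∧ c ∉ TR j ∧ d ∉ TR j ∧ e ∉ TR j) ∨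
      (∃ j : Fin 10, (0 : Fin 16) ∉ TI j ∧ b ∉ TI j ∧ c ∉ TI j ∧ d ∉ TI j ∧ e ∉ TI j) := by
  have h := coverB_eq_true b c d e hbc hcd hde
  simp only [coverB, Bool.or_eq_true, List.any_eq_true, List.mem_finRange, true_and] at h
  rcases h with ⟨j, hj⟩ | ⟨j, hj⟩
  · exact Or.inl ⟨j, not_mem_of_avoidsB hj⟩
  · exact Or.inr ⟨j, not_mem_of_avoidsB hj⟩

/-- A `≤`-sorted list of codes of length at most 5 that contains `0` is covered by a non-decreasing tuple `0, b, c, d, e`. -/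
theorem exists_tuple_of_sorted (L : List (Fin 16)) (hl : L.Pairwise (· ≤ ·)) (hlen : L.length ≤ 5) (h0 : (0 : Fin 16) ∈ L) :
    ∃ b c d e : Fin 16, b ≤ c ∧ c ≤ d ∧ d ≤ e ∧ ∀ x ∈ L, x = 0 ∨ x = b ∨ x = c ∨ x = d ∨ x = e := by
  match L, hl, hlen, h0 with
  | [], _, _, h => simp at h
  | [a], _, _, h =>
    refine ⟨0, 0, 0, 0, le_rfl, le_rfl, le_rfl, ?_⟩
    simp only [List.mem_singleton] at h
    intro x hx; simp only [List.mem_singleton] at hx; subst hx; exact Or.inl h.symm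
  | [a, b], hl, _, h =>
    have hab : a ≤ b := by simp at hl; exact hl
    have ha : a = 0 := le_antisymm (by simp at h; rcases h with h | h; exact h ▸ le_rfl; exact h ▸ hab) (Fin.zero_le _)
    refine ⟨b, b, b, b, le_rfl, le_rfl, le_rfl, ?_⟩
    intro x hx; simp at hx; rcases hx with rfl | rfl
    · exact Or.inl ha
    · exact Or.inr (Or.inl rfl)
  | [a, b, c], hl, _, h =>
    simp at hl
    obtain ⟨⟨hab, hac⟩, hbc⟩ := hl
    have ha : a = 0 := le_antisymm (by simp at h; rcases h with h | h | h; exact h ▸ le_rfl; exact h ▸ hab; exact h ▸ hac) (Fin.zero_le _)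
    refine ⟨b, c, c, c, hbc, le_rfl, le_rfl, ?_⟩
    intro x hx; simp at hx; rcases hx with rfl | rfl | rfl
    · exact Or.inl ha
    · exact Or.inr (Or.inl rfl)
    · exact Or.inr (Or.inr (Or.inl rfl))
  | [a, b, c, d], hl, _, h =>
    simp at hl
    obtain ⟨⟨hab, hac, had⟩, ⟨hbc, hbd⟩, hcd⟩ := hl
    have ha : a = 0 := le_antisymm (by
      simp at h; rcases h with h | h | h | h; exact h ▸ le_rfl; exact h ▸ hab; exact h ▸ hac; exact h ▸ had) (Fin.zero_le _)
    refine ⟨b, c, d, d, hbc, hcd, le_rfl, ?_⟩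
    intro x hx; simp at hx; rcases hx with rfl | rfl | rfl | rfl
    · exact Or.inl ha
    · exact Or.inr (Or.inl rfl)
    · exact Or.inr (Or.inr (Or.inl rfl))
    · exact Or.inr (Or.inr (Or.inr (Or.inl rfl)))
  | [a, b, c, d, e], hl, _, h =>
    simp at hl
    obtain ⟨⟨hab, hac, had, hae⟩, ⟨hbc, hbd, hbe⟩, ⟨hcd, hce⟩, hde⟩ := hl
    have ha : a = 0 := le_antisymm (by
      simp at h; rcases h with h | h | h | h | h; exact h ▸ le_rfl; exact h ▸ hab; exact h ▸ hac; exact h ▸ had; exact h ▸ hae)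
      (Fin.zero_le _)
    refine ⟨b, c, d, e, hbc, hcd, hde, ?_⟩
    intro x hx; simp at hx; rcases hx with rfl | rfl | rfl | rfl | rfl
    · exact Or.inl ha
    · exact Or.inr (Or.inl rfl)
    · exact Or.inr (Or.inr (Or.inl rfl))
    · exact Or.inr (Or.inr (Or.inr (Or.inl rfl)))
    · exact Or.inr (Or.inr (Or.inr (Or.inr rfl)))
  | _ :: _ :: _ :: _ :: _ :: _ :: _, _, hlen, _ => exfalso; simp only [List.length_cons] at hlen; omega

/-- **COVERING LEMMA (set form):** a set of at most five codes containing `0` avoids some `TR j` or some `TI j`. -/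
theorem cover_finset (s : Finset (Fin 16)) (h0 : (0 : Fin 16) ∈ s) (hc : s.card ≤ 5) :
    (∃ j : Fin 10, ∀ x ∈ s, x ∉ TR j) ∨ (∃ j : Fin 10, ∀ x ∈ s, x ∉ TI j) := by
  have hl : (s.sort (· ≤ ·)).Pairwise (· ≤ ·) := Finset.pairwise_sort s (· ≤ ·)
  have hlen : (s.sort (· ≤ ·)).length ≤ 5 := by rw [Finset.length_sort]; exact hc
  have hmem : ∀ x, x ∈ s.sort (· ≤ ·) ↔ x ∈ s := fun x => Finset.mem_sort (· ≤ ·)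
  obtain ⟨b, c, d, e, hbc, hcd, hde, hall⟩ := exists_tuple_of_sorted _ hl hlen ((hmem 0).2 h0)
  rcases cover_tuple b c d e hbc hcd hde with ⟨j, hj0, hjb, hjc, hjd, hje⟩ | ⟨j, hj0, hjb, hjc, hjd, hje⟩
  · left; refine ⟨j, fun x hx => ?_⟩
    rcases hall x ((hmem x).2 hx) with rfl | rfl | rfl | rfl | rfl <;> assumption
  · right; refine ⟨j, fun x hx => ?_⟩
    rcases hall x ((hmem x).2 hx) with rfl | rfl | rfl | rfl | rfl <;> assumption

/-! ## §4 Pure designs on (ℤ∕4)² with at most five letters are axis -/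

/-- A translate of a pure design is pure. -/
theorem shift_pure (d : Letter 2 → ℤ) (hpure : ∀ ε : Eps 2, ε ≠ plus → ε ≠ minus → vmoment d ε = 0) (t : Letter 2) :
    ∀ ε : Eps 2, ε ≠ plus → ε ≠ minus → vmoment (shift d t) ε = 0 := by
  intro ε hp hm
  rw [vmoment_shift, hpure ε hp hm, mul_zero]

/-- The Weil moment of a translate is axis iff the original one is. -/
theorem isAxis_shift_iff (d : Letter 2 → ℤ) (t : Letter 2) : IsAxis (vmoment (shift d t) plus) ↔ IsAxis (vmoment d plus) := by
  rw [vmoment_shift, vchi, isAxis_unitTab_mul_iff]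

/-- **EVERY PURE DESIGN ON (ℤ∕4)² WITH AT MOST FIVE LETTERS HAS A REAL OR PURELY IMAGINARY WEIL MOMENT** (unconditional). -/
theorem isAxis_of_card_le_five (d : Letter 2 → ℤ) (hpure : ∀ ε : Eps 2, ε ≠ plus → ε ≠ minus → vmoment d ε = 0)
    (h5 : (supp d).card ≤ 5) : IsAxis (vmoment d plus) := by
  by_cases hne : (supp d).Nonempty
  · obtain ⟨t, ht⟩ := hne
    have hdt : d t ≠ 0 := (Finset.mem_filter.mp ht).2
    rw [← isAxis_shift_iff d t]
    have hpure' := shift_pure d hpure t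
    -- the codes of the support of the translate: at most five, containing 0
    have h0 : (0 : Fin 16) ∈ (supp (shift d t)).image enc := by
      refine Finset.mem_image.mpr ⟨0, Finset.mem_filter.mpr ⟨Finset.mem_univ _, ?_⟩, by decide⟩
      show d (0 + t) ≠ 0
      rw [zero_add]; exact hdt
    have hc : ((supp (shift d t)).image enc).card ≤ 5 :=
      le_trans Finset.card_image_le (by rw [card_supp_shift]; exact h5)
    rcases cover_finset _ h0 hc with ⟨j, hj⟩ | ⟨j, hj⟩
    · exact Or.inl (re_eq_zero_of_avoids _ hpure' j
        (fun x hx => hj (enc x) (Finset.mem_image_of_mem enc (Finset.mem_filter.mpr ⟨Finset.mem_univ _, hx⟩))))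
    · exact Or.inr (im_eq_zero_of_avoids _ hpure' j
        (fun x hx => hj (enc x) (Finset.mem_image_of_mem enc (Finset.mem_filter.mpr ⟨Finset.mem_univ _, hx⟩))))
  · -- empty support: W = 0
    rw [Finset.not_nonempty_iff_eq_empty] at hne
    have hW : vmoment d plus = 0 := by
      unfold vmoment
      refine Finset.sum_eq_zero (fun x _ => ?_)
      have hx : d x = 0 := by
        by_contra hx
        have : x ∈ supp d := Finset.mem_filter.mpr ⟨Finset.mem_univ _, hx⟩
        rw [hne] at this; simp at this
      simp [hx]
    unfold IsAxis; rw [hW]; exact Or.inl rfl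

/-! ## §5 Consequences: s(3) ≥ 12, s(4) ≥ 24, s(5) ≥ 48, s(6) ≥ 96 in the kernel -/

/-- **s(3) ≥ 12 (UNCONDITIONAL):** every pure W-alive ℤ-design on (ℤ∕4)³ has at least 12 letters — THEOREM B at n = 2 with the class
minima B₁ = 6 (diagonal), B₂ = 4 (axis, `two_pow_le_card_support_pure`), B₃ = 6 (other) supplied by `isAxis_of_card_le_five`. -/
theorem twelve_le_card_supp (m : Letter 3 → ℤ) (hpure : ∀ ε : Eps 3, ε ≠ plus → ε ≠ minus → vmoment m ε = 0)
    (halive : vmoment m plus ≠ 0) : 12 ≤ (supp m).card := by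
  have h := two_mul_min_le_card_supp_of_classes (n := 2) (by norm_num) 6 4 6 ?_ ?_ ?_ m hpure halive
  · simpa using h
  · intro d hd hdiag hne
    by_contra hlt
    exact hne (eq_zero_of_isAxis_of_isDiag _ (isAxis_of_card_le_five d hd (by omega)) hdiag)
  · intro d hd _ hne
    simpa using two_pow_le_card_support_pure 2 (by norm_num) d hd hne
  · intro d hd hnot _
    by_contra hlt
    exact hnot (isAxis_of_card_le_five d hd (by omega))

/-- **s(4) ≥ 24 (UNCONDITIONAL)** by LEMMA S. -/
theorem s4_ge_24 (m : Letter 4 → ℤ) (hpure : ∀ ε : Eps 4, ε ≠ plus → ε ≠ minus → vmoment m ε = 0)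
    (halive : vmoment m plus ≠ 0) : 24 ≤ (supp m).card := by
  simpa using card_support_step (n := 3) (by norm_num) 12 twelve_le_card_supp m hpure halive

/-- **s(5) ≥ 48 (UNCONDITIONAL)** by LEMMA S twice (of record before this file: 32 kernel, 64 machine). -/
theorem s5_ge_48 (m : Letter 5 → ℤ) (hpure : ∀ ε : Eps 5, ε ≠ plus → ε ≠ minus → vmoment m ε = 0)
    (halive : vmoment m plus ≠ 0) : 48 ≤ (supp m).card := by
  simpa using card_support_step (n := 4) (by norm_num) 24 s4_ge_24 m hpure halive

/-- **s(6) ≥ 96 (UNCONDITIONAL)** by LEMMA S thrice (of record before this file: 64 ≤ s(6) ≤ 184 kernel). -/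
theorem s6_ge_96 (m : Letter 6 → ℤ) (hpure : ∀ ε : Eps 6, ε ≠ plus → ε ≠ minus → vmoment m ε = 0)
    (halive : vmoment m plus ≠ 0) : 96 ≤ (supp m).card := by
  simpa using card_support_step (n := 5) (by norm_num) 48 s5_ge_48 m hpure halive

end Summit.Ventures.HSemireg.SignedWeilDesignN
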